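import Mathlib.Data.Nat.Choose.Basic
import Mathlib.Data.Nat.Choose.Sum
import Mathlib.Tactic

/-!
# PercRepro — `C(n + 1, k) ≤ 2·C(n, k)` for `2k ≤ n + 1` (p8 g3, S3)

`proofs/SUBCLAIM-S3-p8.md` §3o. The doubling step of the U-COUNT TAIL lemmas (the rank-`≤ 6` sets counted by the
heavy / light count itself): every binomial `C(p + d, k)` with `k ≤ 6` in the count at most doubles when `p` grows by one,
so the count `U₆(p)` satisfies `U₆(p + 1) ≤ 2·U₆(p)` term by term, and the tail `K·(Σ + U₆ + Σ) ≤ 1000·2^{p+d}` propagates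
by `Nat.le_induction` exactly like night-1's binomial tails. Axioms: standard.
-/

namespace PercRepro

namespace ThmN

/-- `C(n + 1, k) ≤ 2·C(n, k)` when `2k ≤ n + 1` (Pascal: `C(n + 1, k) = C(n, k − 1) + C(n, k)` and `C(n, k − 1) ≤ C(n, k)`
below the middle). -/
theorem choose_succ_le_two_mul (n k : ℕ) (hk : 2 * k ≤ n + 1) : (n + 1).choose k ≤ 2 * n.choose k := by
  rcases k with _ | k
  · simp
  · rw [Nat.choose_succ_succ]
    have h : n.choose k ≤ n.choose (k + 1) := by
      rcases Nat.lt_or_ge k (n / 2) with hlt | hge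
      · exact Nat.choose_le_succ_of_lt_half_left hlt
      · -- `2(k+1) ≤ n + 1` gives `k < n / 2` unless `n = 2k + 1`, the middle: then `C(n, k) = C(n, k + 1)`
        have h2 : n = 2 * k + 1 := by omega
        subst h2
        have := Nat.choose_symm_half k
        omega
    show n.choose k + n.choose (k + 1) ≤ 2 * n.choose (k + 1)
    omega

/-- The same in `ℚ`. -/
theorem choose_succ_le_two_mul_q (n k : ℕ) (hk : 2 * k ≤ n + 1) :
    (((n + 1).choose k : ℕ) : ℚ) ≤ 2 * ((n.choose k : ℕ) : ℚ) := by
  exact_mod_cast choose_succ_le_two_mul n k hk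

end ThmN

end PercRepro
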